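/- WIDTH seat `ym-line-cbag-p1-w3` (prover-ym-line-cbag-p1-w3-g16-0), LINE 7 `GlueballBandRecursion`, in support of ⟨stmt-QuantumFields-22957⟩
`OneParticleBlochSymbolFamily`: Löwdin orthonormalisation, part 2b — LOCALISATION IS PRESERVED.  The Löwdin weights `(1 + ε)^{−1/2}` of a
family whose Gram matrix `1 + ε` has small, off-diagonally decaying `ε` are themselves `1 +` (small, decaying): row sums, and row sums
against any submultiplicative weight, of `(1 + ε)^{−1/2} − 1` are `≤ δ/(1 − δ)`.  Route-independent; definition-free; a helper. -/
import Summits.QuantumFields.YangMills.Theorems.GlueballBandRecursionLowdinSeries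
import Mathlib.Analysis.Matrix.Normed
import Mathlib.Analysis.Matrix.Order
import Mathlib.Analysis.SpecialFunctions.ContinuousFunctionalCalculus.Rpow.Basic

/-!
# Route `GlueballBandRecursion`, item `OneParticleBlochSymbolFamily` (stmt-QuantumFields-22957): Löwdin localisation —
# `(1 + ε)^{−1/2}` inherits smallness and decay from `ε`

Setting: a real symmetric matrix `ε` on a finite index type with weighted row sums `Σ_b |ε_ab|·ω(a,b) ≤ δ ≤ 1/2` for a weight
`ω ≥ 0` with `ω(a,a) = 1` and `ω(a,c) ≤ ω(a,b)·ω(b,c)` (e.g. `ω = e^{c·dist}` or `(1 + dist)²` on the torus `(ℤ/N)³ × species`; `ω ≡ 1`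
is allowed).  Conclusions (`…Lowdin.inv_sqrt_one_add`):
* `(√(1 + ε))⁻¹ = R := Σ_k binom(−1/2, k) ε^k` entrywise (`√` = `CFC.sqrt`, the square root used by `…CovariantFrame`), where the series
  converges entrywise absolutely;
* `Σ_c |(R − 1)_{ac}|·ω(a,c) ≤ δ/(1 − δ)` for every row `a` (`weighted_row_series_sub_one_le`).
Mechanism: `…LowdinSeries` in the row-sum (`ℓ^∞`-operator) norm of `Matrix.Norms.Operator` gives `R·R·(1 + ε) = 1` and convergence;
`R` is symmetric and `1 + (R − 1)` with `R − 1` of row sums `≤ 1`, hence positive semidefinite (Schur test), so `R` IS the non-negative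
square root of `(1 + ε)⁻¹` (`CFC.sqrt_eq_iff`, `PosSemidef.inv_sqrt`); the weighted bound is the majorant series `Σ_k (|ε|^k)` with
`Σ_c (|ε|^k)_{ac} ω(a,c) ≤ δ^k` (submultiplicativity of `ω`).
USE (stub S1 of the item): the Gram matrix `G = 1 + ε` and the matrix elements `H = ⟪φ, 𝕋φ⟫` of the dressed one-plaquette excitations
decay exponentially (cluster expansion); the Löwdin frame `ψ = φ·R` (`…CovariantFrame`) then has hopping kernel `J = R H R/λ₊` with the
same decay, which is what `…SymbolRegularity` (moments `M₀, M₂`, dominance `r₀`) consumes.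

Sources: folklore (Löwdin 1950; Schur test; Neumann/binomial series).  HONEST FRAMING.  Finite-dimensional analysis; item 22957, the rung
`ColdDoublingRecursionStrongCoupling` and the Yang–Mills mass gap / the summit `YangMills` are NOT proved or advanced here.
-/

set_option autoImplicit false

noncomputable section

open Finset Filter Topology Matrix
open scoped MatrixOrder

namespace Summit.QuantumFields.YangMills.Theorems.GlueballBandRecursion.Lowdin

variable {ι : Type*} [Fintype ι] [DecidableEq ι]

/-! ### §1 Majorants: entries of `ε^k` against the entrywise absolute value, weighted row sums -/

/-- `|(ε^k)_{ac}| ≤ (|ε|^k)_{ac}` entrywise (`|ε|` the entrywise absolute value). [folklore] -/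
theorem abs_pow_apply_le (ε : Matrix ι ι ℝ) (k : ℕ) (a c : ι) :
    |(ε ^ k) a c| ≤ ((ε.map fun x : ℝ => |x|) ^ k) a c := by
  induction k generalizing c with
  | zero =>
    rw [pow_zero, pow_zero, Matrix.one_apply]
    split_ifs <;> simp
  | succ k ih =>
    rw [pow_succ, pow_succ, Matrix.mul_apply, Matrix.mul_apply]
    refine (abs_sum_le_sum_abs _ _).trans (Finset.sum_le_sum fun d _ => ?_)
    rw [abs_mul, Matrix.map_apply]
    exact mul_le_mul_of_nonneg_right (ih d) (abs_nonneg _)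

/-- **Weighted row sums of the majorant powers**: if `Σ_b |ε_ab| ω(a,b) ≤ δ` for all `a`, `ω ≥ 0`, `ω(a,a) = 1`,
`ω(a,c) ≤ ω(a,b) ω(b,c)`, then `Σ_c (|ε|^k)_{ac} ω(a,c) ≤ δ^k`. [folklore] -/
theorem weighted_row_abs_pow_le (ε : Matrix ι ι ℝ) (ω : ι → ι → ℝ) (hω0 : ∀ a b, 0 ≤ ω a b) (hωd : ∀ a, ω a a = 1)
    (hωm : ∀ a b c, ω a c ≤ ω a b * ω b c) {δ : ℝ} (hrow : ∀ a, ∑ b, |ε a b| * ω a b ≤ δ) (k : ℕ) (a : ι) :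
    ∑ c, ((ε.map fun x : ℝ => |x|) ^ k) a c * ω a c ≤ δ ^ k := by
  have hδ : 0 ≤ δ := (Finset.sum_nonneg fun b _ => mul_nonneg (abs_nonneg _) (hω0 a b)).trans (hrow a)
  have hη0 : ∀ (m : ℕ) (a c : ι), 0 ≤ ((ε.map fun x : ℝ => |x|) ^ m) a c := fun m a c =>
    (abs_nonneg _).trans (abs_pow_apply_le ε m a c)
  induction k generalizing a with
  | zero =>
    rw [pow_zero, pow_zero, Finset.sum_eq_single a]
    · rw [Matrix.one_apply_eq, hωd, one_mul]
    · intro c _ hca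
      rw [Matrix.one_apply_ne' hca, zero_mul]
    · exact fun h => absurd (Finset.mem_univ a) h
  | succ k ih =>
    calc ∑ c, ((ε.map fun x : ℝ => |x|) ^ (k + 1)) a c * ω a c
        = ∑ c, ∑ d, ((ε.map fun x : ℝ => |x|) ^ k) a d * |ε d c| * ω a c := by
          refine Finset.sum_congr rfl fun c _ => ?_
          rw [pow_succ, Matrix.mul_apply, Finset.sum_mul]
          rfl
      _ ≤ ∑ c, ∑ d, ((ε.map fun x : ℝ => |x|) ^ k) a d * ω a d * (|ε d c| * ω d c) := by
          refine Finset.sum_le_sum fun c _ => Finset.sum_le_sum fun d _ => ?_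
          calc ((ε.map fun x : ℝ => |x|) ^ k) a d * |ε d c| * ω a c
              ≤ ((ε.map fun x : ℝ => |x|) ^ k) a d * |ε d c| * (ω a d * ω d c) :=
                mul_le_mul_of_nonneg_left (hωm a d c) (mul_nonneg (hη0 k a d) (abs_nonneg _))
            _ = ((ε.map fun x : ℝ => |x|) ^ k) a d * ω a d * (|ε d c| * ω d c) := by ring
      _ = ∑ d, ((ε.map fun x : ℝ => |x|) ^ k) a d * ω a d * ∑ c, |ε d c| * ω d c := by
          rw [Finset.sum_comm]
          exact Finset.sum_congr rfl fun d _ => by rw [Finset.mul_sum]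
      _ ≤ ∑ d, ((ε.map fun x : ℝ => |x|) ^ k) a d * ω a d * δ :=
          Finset.sum_le_sum fun d _ => mul_le_mul_of_nonneg_left (hrow d) (mul_nonneg (hη0 k a d) (hω0 a d))
      _ ≤ δ ^ k * δ := by
          rw [← Finset.sum_mul]
          exact mul_le_mul_of_nonneg_right (ih a) hδ
      _ = δ ^ (k + 1) := (pow_succ δ k).symm

/-! ### §2 The Schur test: symmetric matrices with small row sums -/

omit [DecidableEq ι] in
/-- **Schur test** for a real symmetric matrix: `|xᵀ D x| ≤ (max row sum of |D|)·xᵀx`. [folklore] -/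
theorem abs_dotProduct_mulVec_le (D : Matrix ι ι ℝ) (hD : Dᵀ = D) {d : ℝ} (hrow : ∀ a, ∑ b, |D a b| ≤ d)
    (x : ι → ℝ) : |x ⬝ᵥ (D *ᵥ x)| ≤ d * (x ⬝ᵥ x) := by
  have hcol : ∀ b, ∑ a, |D a b| ≤ d := fun b => by
    have h := hrow b
    simp_rw [← congr_fun (congr_fun hD b), Matrix.transpose_apply] at h
    exact h
  have key : ∀ a b, |x a * (D a b * x b)| ≤ |D a b| * x a ^ 2 / 2 + |D a b| * x b ^ 2 / 2 := by
    intro a b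
    rw [show x a * (D a b * x b) = D a b * (x a * x b) by ring, abs_mul]
    have h2 : |x a * x b| ≤ (x a ^ 2 + x b ^ 2) / 2 := by
      rw [abs_le]
      constructor <;> nlinarith [sq_nonneg (x a + x b), sq_nonneg (x a - x b)]
    nlinarith [abs_nonneg (D a b)]
  have hS1 : ∑ a, ∑ b, |D a b| * x a ^ 2 / 2 ≤ d * (∑ a, x a ^ 2) / 2 := by
    rw [Finset.mul_sum, Finset.sum_div]
    refine Finset.sum_le_sum fun a _ => ?_
    rw [← Finset.sum_div, ← Finset.sum_mul]
    have hx : 0 ≤ x a ^ 2 := sq_nonneg _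
    exact div_le_div_of_nonneg_right (mul_le_mul_of_nonneg_right (hrow a) hx) zero_le_two
  have hS2 : ∑ a, ∑ b, |D a b| * x b ^ 2 / 2 ≤ d * (∑ b, x b ^ 2) / 2 := by
    rw [Finset.sum_comm, Finset.mul_sum, Finset.sum_div]
    refine Finset.sum_le_sum fun b _ => ?_
    rw [← Finset.sum_div, ← Finset.sum_mul]
    have hx : 0 ≤ x b ^ 2 := sq_nonneg _
    exact div_le_div_of_nonneg_right (mul_le_mul_of_nonneg_right (hcol b) hx) zero_le_two
  have hxx : x ⬝ᵥ x = ∑ a, x a ^ 2 := by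
    simp only [dotProduct, sq]
  rw [hxx]
  calc |x ⬝ᵥ (D *ᵥ x)| = |∑ a, ∑ b, x a * (D a b * x b)| := by
        simp only [dotProduct, Matrix.mulVec, Finset.mul_sum]
    _ ≤ ∑ a, ∑ b, |x a * (D a b * x b)| :=
        (abs_sum_le_sum_abs _ _).trans (Finset.sum_le_sum fun a _ => abs_sum_le_sum_abs _ _)
    _ ≤ ∑ a, ∑ b, (|D a b| * x a ^ 2 / 2 + |D a b| * x b ^ 2 / 2) :=
        Finset.sum_le_sum fun a _ => Finset.sum_le_sum fun b _ => key a b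
    _ = ∑ a, ∑ b, |D a b| * x a ^ 2 / 2 + ∑ a, ∑ b, |D a b| * x b ^ 2 / 2 := by
        rw [← Finset.sum_add_distrib]
        exact Finset.sum_congr rfl fun a _ => Finset.sum_add_distrib
    _ ≤ d * (∑ a, x a ^ 2) / 2 + d * (∑ b, x b ^ 2) / 2 := add_le_add hS1 hS2
    _ = d * ∑ a, x a ^ 2 := by ring

/-- `1 + D` is positive semidefinite for symmetric `D` with row sums `≤ 1`. [folklore] -/
theorem posSemidef_one_add (D : Matrix ι ι ℝ) (hD : Dᵀ = D) (hrow : ∀ a, ∑ b, |D a b| ≤ 1) :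
    (1 + D).PosSemidef := by
  refine PosSemidef.of_dotProduct_mulVec_nonneg ?_ fun x => ?_
  · rw [Matrix.IsHermitian, Matrix.conjTranspose_eq_transpose_of_trivial, Matrix.transpose_add, Matrix.transpose_one, hD]
  · have h := abs_dotProduct_mulVec_le D hD hrow x
    rw [star_trivial, Matrix.add_mulVec, Matrix.one_mulVec, dotProduct_add]
    have h2 : -(1 * (x ⬝ᵥ x)) ≤ x ⬝ᵥ (D *ᵥ x) := (abs_le.1 h).1
    linarith

/-! ### §3 The series in the row-sum norm -/

section OperatorNorm

open scoped Matrix.Norms.Operator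

/-- Row sums bound the `ℓ^∞`-operator norm: `(∀ a, Σ_b |A_ab| ≤ δ) → ‖A‖ ≤ δ` (`δ ≥ 0`). -/
theorem linfty_opNorm_le_of_rows (A : Matrix ι ι ℝ) {δ : ℝ} (hδ : 0 ≤ δ) (h : ∀ a, ∑ b, |A a b| ≤ δ) : ‖A‖ ≤ δ := by
  rw [Matrix.linfty_opNorm_def]
  have h' : ∀ i, (∑ j : ι, ‖A i j‖₊ : NNReal) ≤ ⟨δ, hδ⟩ := fun i => by
    rw [← NNReal.coe_le_coe, NNReal.coe_sum]
    change ∑ j, (‖A i j‖₊ : ℝ) ≤ δ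
    simpa only [coe_nnnorm, Real.norm_eq_abs] using h i
  exact NNReal.coe_le_coe.2 (Finset.sup_le fun i _ => h' i)

/-- Every row sum is below the `ℓ^∞`-operator norm. -/
theorem row_le_linfty_opNorm (A : Matrix ι ι ℝ) (a : ι) : ∑ b, |A a b| ≤ ‖A‖ := by
  rw [Matrix.linfty_opNorm_def]
  have h : (∑ j : ι, ‖A a j‖₊) ≤ (Finset.univ : Finset ι).sup fun i : ι => ∑ j : ι, ‖A i j‖₊ :=
    Finset.le_sup (f := fun i : ι => ∑ j : ι, ‖A i j‖₊) (Finset.mem_univ a)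
  have h' := NNReal.coe_le_coe.2 h
  rw [NNReal.coe_sum] at h'
  simpa only [coe_nnnorm, Real.norm_eq_abs] using h'

/-- **The binomial series in the row-sum norm** (export in norm-free form): for `Σ_b |ε_ab| ≤ δ < 1` there is a matrix `R` with
`R_{ac} = Σ_k (binom(−1/2,k)·ε^k)_{ac}` entrywise (convergent), `R·R·(1 + ε) = 1 = (1 + ε)·R·R`, and `Σ_c |(R − 1)_{ac}| ≤ δ/(1 − δ)`. -/
theorem exists_series_matrix (ε : Matrix ι ι ℝ) {δ : ℝ} (hδ0 : 0 ≤ δ) (hδ : δ < 1) (hrow : ∀ a, ∑ b, |ε a b| ≤ δ) :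
    ∃ R : Matrix ι ι ℝ,
      (∀ a c, HasSum (fun k => (Ring.choose (-(1 / 2 : ℝ)) k • ε ^ k) a c) (R a c)) ∧
      R * R * (1 + ε) = 1 ∧ (1 + ε) * (R * R) = 1 ∧ ∀ a, ∑ c, |(R - 1) a c| ≤ δ / (1 - δ) := by
  have hε : ‖ε‖ < 1 := (linfty_opNorm_le_of_rows ε hδ0 hrow).trans_lt hδ
  have hs := summable_choose_smul_pow ε hε
  refine ⟨∑' k, Ring.choose (-(1 / 2 : ℝ)) k • ε ^ k, fun a c => ?_, (series_mul_self_mul_one_add ε hε).1,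
    (series_mul_self_mul_one_add ε hε).2, fun a => ?_⟩
  · exact Pi.hasSum.1 (Pi.hasSum.1 hs.hasSum a) c
  · refine (row_le_linfty_opNorm _ a).trans ((norm_series_sub_one_le ε hε).trans ?_)
    have h1 : 0 < 1 - ‖ε‖ := by linarith
    have h2 : 0 < 1 - δ := by linarith
    rw [div_le_div_iff₀ h1 h2]
    nlinarith [linfty_opNorm_le_of_rows ε hδ0 hrow, norm_nonneg ε]

end OperatorNorm

/-! ### §4 The Löwdin weights `(√(1 + ε))⁻¹`: series representation, smallness and weighted decay -/

/-- **Löwdin localisation.**  Let `ε` be real symmetric with row sums `Σ_b |ε_ab| ≤ δ ≤ 1/2`.  Then the Löwdin weight matrix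
`(√(1 + ε))⁻¹` (`CFC.sqrt`, as in `…CovariantFrame`) IS the binomial series `Σ_k binom(−1/2, k) ε^k` (entrywise convergent sums), and
`Σ_c |((√(1 + ε))⁻¹ − 1)_{ac}| ≤ δ/(1 − δ)` for every row. [folklore] -/
theorem inv_sqrt_one_add (ε : Matrix ι ι ℝ) (hεT : εᵀ = ε) {δ : ℝ} (hδ0 : 0 ≤ δ) (hδ : δ ≤ 1 / 2)
    (hrow : ∀ a, ∑ b, |ε a b| ≤ δ) :
    (∀ a c, HasSum (fun k => (Ring.choose (-(1 / 2 : ℝ)) k • ε ^ k) a c) (((CFC.sqrt (1 + ε))⁻¹) a c)) ∧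
      ∀ a, ∑ c, |((CFC.sqrt (1 + ε))⁻¹ - 1) a c| ≤ δ / (1 - δ) := by
  obtain ⟨R, hR, hR1, -, hRrow⟩ := exists_series_matrix ε hδ0 (by linarith) hrow
  -- `R` is symmetric
  have hRT : Rᵀ = R := by
    ext a c
    rw [Matrix.transpose_apply]
    refine (hR c a).unique ((hR a c).congr_fun fun k => ?_)   -- careful with congr_fun direction
    rw [Matrix.smul_apply, Matrix.smul_apply, ← Matrix.transpose_apply (ε ^ k) a c, Matrix.transpose_pow, hεT]
  -- `R = 1 + (R - 1)` is positive semidefinite (row sums of `R - 1` are `≤ δ/(1-δ) ≤ 1`)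
  have hδ' : δ / (1 - δ) ≤ 1 := by
    rw [div_le_one (by linarith)]
    linarith
  have hR0 : R.PosSemidef := by
    have h := posSemidef_one_add (R - 1) (by rw [Matrix.transpose_sub, Matrix.transpose_one, hRT])
      (fun a => (hRrow a).trans hδ')
    rwa [add_sub_cancel] at h
  have hG : (1 + ε).PosSemidef := posSemidef_one_add ε hεT (fun a => (hrow a).trans (by linarith))
  have hsqrt : (CFC.sqrt (1 + ε))⁻¹ = R := by
    rw [hG.inv_sqrt]
    exact (CFC.sqrt_eq_iff (1 + ε)⁻¹ R hG.inv.nonneg hR0.nonneg).2 (Matrix.inv_eq_left_inv hR1).symm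
  rw [hsqrt]
  exact ⟨hR, hRrow⟩

/-- **Weighted Löwdin localisation.**  If `Σ_b |ε_ab|·ω(a,b) ≤ δ ≤ 1/2` for a weight `ω ≥ 1` with `ω(a,a) = 1` and
`ω(a,c) ≤ ω(a,b)·ω(b,c)`, then `Σ_c |((√(1 + ε))⁻¹ − 1)_{ac}|·ω(a,c) ≤ δ/(1 − δ)`: the Löwdin weights have the decay of `ε`
(exponential weights `ω = e^{κ·dist}` give exponential decay, polynomial weights give moment bounds). [folklore] -/
theorem weighted_row_inv_sqrt_sub_one_le (ε : Matrix ι ι ℝ) (hεT : εᵀ = ε) (ω : ι → ι → ℝ) (hω1 : ∀ a b, 1 ≤ ω a b)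
    (hωd : ∀ a, ω a a = 1) (hωm : ∀ a b c, ω a c ≤ ω a b * ω b c) {δ : ℝ} (hδ : δ ≤ 1 / 2)
    (hrow : ∀ a, ∑ b, |ε a b| * ω a b ≤ δ) (a : ι) :
    ∑ c, |((CFC.sqrt (1 + ε))⁻¹ - 1) a c| * ω a c ≤ δ / (1 - δ) := by
  have hω0 : ∀ a b, 0 ≤ ω a b := fun a b => zero_le_one.trans (hω1 a b)
  have hδ0 : 0 ≤ δ := (Finset.sum_nonneg fun b _ => mul_nonneg (abs_nonneg _) (hω0 a b)).trans (hrow a)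
  have hδ1 : δ < 1 := by linarith
  have hrow' : ∀ a, ∑ b, |ε a b| ≤ δ := fun a =>
    (Finset.sum_le_sum fun b _ => le_mul_of_one_le_right (abs_nonneg _) (hω1 a b)).trans (hrow a)
  obtain ⟨hR, -⟩ := inv_sqrt_one_add ε hεT hδ0 hδ hrow'
  set R : Matrix ι ι ℝ := (CFC.sqrt (1 + ε))⁻¹ with hRdef
  set η : Matrix ι ι ℝ := ε.map fun x : ℝ => |x| with hηdef
  -- the shifted series for `R - 1`
  have hR' : ∀ c, HasSum (fun k => (Ring.choose (-(1 / 2 : ℝ)) (k + 1) • ε ^ (k + 1)) a c) ((R - 1) a c) := by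
    intro c
    have h := (hasSum_nat_add_iff' 1).2 (hR a c)
    rw [Finset.sum_range_one, Ring.choose_zero_right, one_smul, pow_zero] at h
    rwa [Matrix.sub_apply]
  -- termwise weighted majorant `≤ (|ε|^(k+1))_{ac} ω(a,c)`, whose row sums are `≤ δ^(k+1)`
  have hη0 : ∀ k c, 0 ≤ (η ^ (k + 1)) a c * ω a c := fun k c =>
    mul_nonneg ((abs_nonneg _).trans (abs_pow_apply_le ε _ a c)) (hω0 a c)
  have hmaj : ∀ k c, |(Ring.choose (-(1 / 2 : ℝ)) (k + 1) • ε ^ (k + 1)) a c| * ω a c ≤ (η ^ (k + 1)) a c * ω a c := by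
    intro k c
    refine mul_le_mul_of_nonneg_right ?_ (hω0 a c)
    rw [Matrix.smul_apply, smul_eq_mul, abs_mul]
    calc |Ring.choose (-(1 / 2 : ℝ)) (k + 1)| * |(ε ^ (k + 1)) a c| ≤ 1 * (η ^ (k + 1)) a c :=
          mul_le_mul (abs_choose_neg_half_le_one _) (abs_pow_apply_le ε _ a c) (abs_nonneg _) zero_le_one
      _ = (η ^ (k + 1)) a c := one_mul _
  have hηrow : ∀ k, ∑ c, (η ^ (k + 1)) a c * ω a c ≤ δ ^ (k + 1) := fun k =>
    weighted_row_abs_pow_le ε ω hω0 hωd hωm hrow (k + 1) a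
  have hgeo : Summable (fun k : ℕ => δ ^ (k + 1)) :=
    ((summable_geometric_of_lt_one hδ0 hδ1).mul_left δ).congr fun k => (pow_succ' δ k).symm
  have hsum_maj : ∀ c, Summable (fun k => (η ^ (k + 1)) a c * ω a c) := fun c =>
    Summable.of_nonneg_of_le (fun k => hη0 k c)
      (fun k => (Finset.single_le_sum (fun c' _ => hη0 k c') (Finset.mem_univ c)).trans (hηrow k)) hgeo
  have hsum_abs : ∀ c, Summable (fun k => |(Ring.choose (-(1 / 2 : ℝ)) (k + 1) • ε ^ (k + 1)) a c| * ω a c) :=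
    fun c => Summable.of_nonneg_of_le (fun k => mul_nonneg (abs_nonneg _) (hω0 a c)) (fun k => hmaj k c) (hsum_maj c)
  -- entrywise: `|(R − 1)_{ac}| ω(a,c) ≤ Σ'_k |term_k| ω(a,c)`
  have hentry : ∀ c, |(R - 1) a c| * ω a c ≤
      ∑' k, |(Ring.choose (-(1 / 2 : ℝ)) (k + 1) • ε ^ (k + 1)) a c| * ω a c := by
    intro c
    have hs : Summable (fun k => ‖(Ring.choose (-(1 / 2 : ℝ)) (k + 1) • ε ^ (k + 1)) a c‖) := by
      refine Summable.of_nonneg_of_le (fun k => norm_nonneg _) (fun k => ?_) (hsum_abs c)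
      rw [Real.norm_eq_abs]
      exact le_mul_of_one_le_right (abs_nonneg _) (hω1 a c)
    have h1 : |(R - 1) a c| ≤ ∑' k, |(Ring.choose (-(1 / 2 : ℝ)) (k + 1) • ε ^ (k + 1)) a c| := by
      rw [← (hR' c).tsum_eq]
      have h := norm_tsum_le_tsum_norm hs
      simpa only [Real.norm_eq_abs] using h
    calc |(R - 1) a c| * ω a c ≤ (∑' k, |(Ring.choose (-(1 / 2 : ℝ)) (k + 1) • ε ^ (k + 1)) a c|) * ω a c :=
          mul_le_mul_of_nonneg_right h1 (hω0 a c)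
      _ = ∑' k, |(Ring.choose (-(1 / 2 : ℝ)) (k + 1) • ε ^ (k + 1)) a c| * ω a c := tsum_mul_right.symm
  calc ∑ c, |(R - 1) a c| * ω a c
      ≤ ∑ c, ∑' k, |(Ring.choose (-(1 / 2 : ℝ)) (k + 1) • ε ^ (k + 1)) a c| * ω a c :=
        Finset.sum_le_sum fun c _ => hentry c
    _ = ∑' k, ∑ c, |(Ring.choose (-(1 / 2 : ℝ)) (k + 1) • ε ^ (k + 1)) a c| * ω a c :=
        (Summable.tsum_finsetSum fun c _ => hsum_abs c).symm
    _ ≤ ∑' k, δ ^ (k + 1) :=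
        Summable.tsum_le_tsum (fun k => (Finset.sum_le_sum fun c _ => hmaj k c).trans (hηrow k))
          (summable_sum fun c _ => hsum_abs c) hgeo
    _ = δ / (1 - δ) := by
        rw [show (fun k : ℕ => δ ^ (k + 1)) = fun k : ℕ => δ * δ ^ k from funext fun k => pow_succ' δ k, tsum_mul_left,
          tsum_geometric_of_lt_one hδ0 hδ1, div_eq_mul_inv]

end Summit.QuantumFields.YangMills.Theorems.GlueballBandRecursion.Lowdin

end
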